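import Summits.RiemannHypothesis.RiemannHypothesis.Theorems.SoloInformedGroundStateLeak
import Mathlib.Analysis.Calculus.BumpFunction.Normed

/-!
# Ground-state endgame, VIII: an explicit seed

Solo programme `solo-RiemannHypothesis-informed`, session 2. An explicit even Schwartz seed
`seed : 𝓢(ℝ, ℂ)` supported in `[-1, 1]` with `seed 0 = 0 = ∫ seed` (the two moment conditions of
the Poisson bound, part VII) and with `𝓜 seed (2) ≠ 0` (used for the size of the window function
from below): `seed(x) = b(x) + b(-x) − 2 b(2x) − 2 b(−2x)` for a smooth bump `b ≥ 0` supported in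
`(1/2, 1)` with `b(3/4) = 1`.
-/

noncomputable section

open Complex Filter Set Topology MeasureTheory
open scoped ContDiff
open Literature.NumberTheory.LFunctions

namespace Summit.RiemannHypothesis.RiemannHypothesis.Theorems

/-! ## The bump and the real profile -/

/-- The smooth bump centred at `3/4` with radii `1/8 < 1/4`: equal to `1` on `[5/8, 7/8]`,
supported in `(1/2, 1)`. -/
def seedBump : ContDiffBump (3 / 4 : ℝ) where
  rIn := 1 / 8
  rOut := 1 / 4
  rIn_pos := by norm_num
  rIn_lt_rOut := by norm_num

/-- `b(y) = 0` unless `1/2 < y < 1`. -/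
theorem seedBump_eq_zero {y : ℝ} (hy : y ≤ 1 / 2 ∨ 1 ≤ y) : (seedBump : ℝ → ℝ) y = 0 := by
  apply seedBump.zero_of_le_dist
  show (1 / 4 : ℝ) ≤ dist y (3 / 4)
  rw [Real.dist_eq]
  rcases hy with hy | hy
  · rw [abs_of_nonpos (by linarith)]; linarith
  · rw [abs_of_nonneg (by linarith)]; linarith

/-- `b ≥ 0`. -/
theorem seedBump_nonneg (y : ℝ) : 0 ≤ (seedBump : ℝ → ℝ) y := seedBump.nonneg

/-- `b(3/4) = 1`. -/
theorem seedBump_center : (seedBump : ℝ → ℝ) (3 / 4) = 1 :=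
  seedBump.one_of_mem_closedBall (Metric.mem_closedBall_self seedBump.rIn_pos.le)

/-- The real profile `b(x) + b(-x) − 2 b(2x) − 2 b(−2x)`. -/
def seedRe (x : ℝ) : ℝ :=
  (seedBump : ℝ → ℝ) x + (seedBump : ℝ → ℝ) (-x) -
    2 * (seedBump : ℝ → ℝ) (2 * x) - 2 * (seedBump : ℝ → ℝ) (-(2 * x))

/-- Smoothness of the profile. -/
theorem contDiff_seedRe : ContDiff ℝ ∞ seedRe := by
  have hb : ContDiff ℝ ∞ (seedBump : ℝ → ℝ) := seedBump.contDiff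
  have h1 : ContDiff ℝ ∞ fun x : ℝ => (seedBump : ℝ → ℝ) (-x) := hb.comp contDiff_neg
  have h2 : ContDiff ℝ ∞ fun x : ℝ => (seedBump : ℝ → ℝ) (2 * x) :=
    hb.comp (contDiff_const.mul contDiff_id)
  have h3 : ContDiff ℝ ∞ fun x : ℝ => (seedBump : ℝ → ℝ) (-(2 * x)) :=
    hb.comp (contDiff_const.mul contDiff_id).neg
  unfold seedRe
  exact ((hb.add h1).sub (contDiff_const.mul h2)).sub (contDiff_const.mul h3)

/-- Continuity of the profile. -/
theorem continuous_seedRe : Continuous seedRe := contDiff_seedRe.continuous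

/-- The profile is even. -/
theorem seedRe_even (x : ℝ) : seedRe (-x) = seedRe x := by
  unfold seedRe
  rw [neg_neg, show 2 * -x = -(2 * x) by ring, neg_neg]
  ring

/-- `seedRe 0 = 0`. -/
theorem seedRe_zero : seedRe 0 = 0 := by
  unfold seedRe
  rw [neg_zero, mul_zero, neg_zero, seedBump_eq_zero (Or.inl (by norm_num))]
  ring

/-- The profile vanishes for `|x| ≥ 1`. -/
theorem seedRe_eq_zero_of_one_le {x : ℝ} (hx : 1 ≤ |x|) : seedRe x = 0 := by
  unfold seedRe
  rcases le_or_gt 0 x with h | h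
  · rw [abs_of_nonneg h] at hx
    rw [seedBump_eq_zero (Or.inr hx), seedBump_eq_zero (Or.inl (by linarith)),
      seedBump_eq_zero (Or.inr (by linarith)), seedBump_eq_zero (Or.inl (by linarith))]
    ring
  · rw [abs_of_neg h] at hx
    rw [seedBump_eq_zero (Or.inl (by linarith)), seedBump_eq_zero (Or.inr (by linarith)),
      seedBump_eq_zero (Or.inl (by linarith)), seedBump_eq_zero (Or.inr (by linarith))]
    ring

/-- On `x ≥ 1/2` only the first bump survives: `seedRe x = b(x)`. -/
theorem seedRe_of_half_le {x : ℝ} (hx : 1 / 2 ≤ x) : seedRe x = (seedBump : ℝ → ℝ) x := by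
  unfold seedRe
  rw [seedBump_eq_zero (y := -x) (Or.inl (by linarith)),
    seedBump_eq_zero (y := 2 * x) (Or.inr (by linarith)),
    seedBump_eq_zero (y := -(2 * x)) (Or.inl (by linarith))]
  ring

/-- On `0 ≤ x`: `seedRe x = b(x) − 2 b(2x)`. -/
theorem seedRe_of_nonneg {x : ℝ} (hx : 0 ≤ x) :
    seedRe x = (seedBump : ℝ → ℝ) x - 2 * (seedBump : ℝ → ℝ) (2 * x) := by
  unfold seedRe
  rw [seedBump_eq_zero (y := -x) (Or.inl (by linarith)),
    seedBump_eq_zero (y := -(2 * x)) (Or.inl (by linarith))]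
  ring

/-- Compact support. -/
theorem hasCompactSupport_seedRe : HasCompactSupport seedRe :=
  HasCompactSupport.intro (K := Icc (-1 : ℝ) 1) isCompact_Icc fun x hx =>
    seedRe_eq_zero_of_one_le (by
      rcases le_or_gt 0 x with h | h
      · rw [abs_of_nonneg h]
        by_contra h'
        exact hx ⟨by linarith, le_of_lt (not_le.1 h')⟩
      · rw [abs_of_neg h]
        by_contra h'
        exact hx ⟨by linarith [not_le.1 h'], by linarith⟩)

/-- The bump is integrable, and so are its dilates/reflections. -/
theorem integrable_seedBump_comp {c : ℝ} (hc : c ≠ 0) :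
    Integrable (fun x : ℝ => (seedBump : ℝ → ℝ) (c * x)) volume :=
  (seedBump.continuous.integrable_of_hasCompactSupport seedBump.hasCompactSupport).comp_mul_left' hc

/-- **Vanishing integral**: `∫ seedRe = 0` (`∫ b(±x) = I`, `∫ b(±2x) = I/2`). -/
theorem integral_seedRe : ∫ x : ℝ, seedRe x = 0 := by
  set I : ℝ := ∫ x : ℝ, (seedBump : ℝ → ℝ) x with hI
  have i0 : Integrable (fun x : ℝ => (seedBump : ℝ → ℝ) x) volume :=
    seedBump.continuous.integrable_of_hasCompactSupport seedBump.hasCompactSupport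
  have i1 : Integrable (fun x : ℝ => (seedBump : ℝ → ℝ) (-x)) volume := i0.comp_neg
  have i2 : Integrable (fun x : ℝ => (seedBump : ℝ → ℝ) (2 * x)) volume :=
    integrable_seedBump_comp two_ne_zero
  have i3 : Integrable (fun x : ℝ => (seedBump : ℝ → ℝ) (-(2 * x))) volume := by
    have := integrable_seedBump_comp (c := -2) (by norm_num)
    refine this.congr (Eventually.of_forall fun x => ?_)
    simp only [neg_mul]
  have e1 : ∫ x : ℝ, (seedBump : ℝ → ℝ) (-x) = I := integral_neg_eq_self _ _
  have e2 : ∫ x : ℝ, (seedBump : ℝ → ℝ) (2 * x) = I / 2 := by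
    rw [Measure.integral_comp_mul_left (fun y : ℝ => (seedBump : ℝ → ℝ) y) 2]
    rw [smul_eq_mul, abs_of_pos (by norm_num : (0 : ℝ) < 2⁻¹), ← hI]
    ring
  have e3 : ∫ x : ℝ, (seedBump : ℝ → ℝ) (-(2 * x)) = I / 2 := by
    have : (fun x : ℝ => (seedBump : ℝ → ℝ) (-(2 * x))) = fun x => (seedBump : ℝ → ℝ) ((-2) * x) := by
      funext x; rw [neg_mul]
    rw [this, Measure.integral_comp_mul_left (fun y : ℝ => (seedBump : ℝ → ℝ) y) (-2)]
    rw [smul_eq_mul, show |((-2 : ℝ))⁻¹| = 1 / 2 by norm_num, ← hI]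
    ring
  have i01 : Integrable (fun x : ℝ => (seedBump : ℝ → ℝ) x + (seedBump : ℝ → ℝ) (-x)) volume :=
    i0.add i1
  have i2' : Integrable (fun x : ℝ => 2 * (seedBump : ℝ → ℝ) (2 * x)) volume := i2.const_mul 2
  have i3' : Integrable (fun x : ℝ => 2 * (seedBump : ℝ → ℝ) (-(2 * x))) volume := i3.const_mul 2
  have i012 : Integrable (fun x : ℝ => (seedBump : ℝ → ℝ) x + (seedBump : ℝ → ℝ) (-x)
      - 2 * (seedBump : ℝ → ℝ) (2 * x)) volume := i01.sub i2'
  have step : ∫ x : ℝ, seedRe x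
      = (∫ x : ℝ, (seedBump : ℝ → ℝ) x) + (∫ x : ℝ, (seedBump : ℝ → ℝ) (-x))
        - 2 * (∫ x : ℝ, (seedBump : ℝ → ℝ) (2 * x)) - 2 * ∫ x : ℝ, (seedBump : ℝ → ℝ) (-(2 * x)) := by
    unfold seedRe
    rw [integral_sub i012 i3', integral_sub i01 i2', integral_add i0 i1, integral_const_mul,
      integral_const_mul]
  rw [step, ← hI, e1, e2, e3]
  ring

/-- **First moment of the bump is positive**: `0 < ∫ x b(x) dx`. -/
theorem integral_mul_seedBump_pos : 0 < ∫ x : ℝ, x * (seedBump : ℝ → ℝ) x := by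
  have hc : Continuous fun x : ℝ => x * (seedBump : ℝ → ℝ) x := continuous_id.mul seedBump.continuous
  have hs : HasCompactSupport fun x : ℝ => x * (seedBump : ℝ → ℝ) x :=
    seedBump.hasCompactSupport.mul_left
  have hnn : 0 ≤ fun x : ℝ => x * (seedBump : ℝ → ℝ) x := by
    intro x
    simp only [Pi.zero_apply]
    rcases le_or_gt x (1 / 2) with h | h
    · rw [seedBump_eq_zero (Or.inl h), mul_zero]
    · exact mul_nonneg (by linarith) (seedBump_nonneg x)
  have hx : (fun x : ℝ => x * (seedBump : ℝ → ℝ) x) (3 / 4) ≠ 0 := by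
    simp only [seedBump_center, mul_one]; norm_num
  exact hc.integral_pos_of_hasCompactSupport_nonneg_nonzero hs hnn hx

/-! ## The complex seed as a Schwartz function -/

/-- Compact support of the complexified profile. -/
theorem hasCompactSupport_seedC : HasCompactSupport fun x : ℝ => (seedRe x : ℂ) :=
  hasCompactSupport_seedRe.comp_left Complex.ofReal_zero

/-- Smoothness of the complexified profile. -/
theorem contDiff_seedC : ContDiff ℝ ∞ fun x : ℝ => (seedRe x : ℂ) :=
  Complex.ofRealCLM.contDiff.comp contDiff_seedRe

/-- **The seed** `seed : 𝓢(ℝ, ℂ)`. -/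
def seed : SchwartzMap ℝ ℂ := hasCompactSupport_seedC.toSchwartzMap contDiff_seedC

/-- Pointwise formula. -/
@[simp] theorem seed_apply (x : ℝ) : seed x = (seedRe x : ℂ) := rfl

/-- The seed is even. -/
theorem seed_even (x : ℝ) : seed (-x) = seed x := by
  rw [seed_apply, seed_apply, seedRe_even]

/-- `seed 0 = 0`. -/
theorem seed_zero : seed 0 = 0 := by
  rw [seed_apply, seedRe_zero, Complex.ofReal_zero]

/-- `∫ seed = 0`. -/
theorem integral_seed : ∫ x : ℝ, seed x = 0 := by
  simp only [seed_apply]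
  rw [integral_complex_ofReal, integral_seedRe, Complex.ofReal_zero]

/-- The seed vanishes beyond `1`. -/
theorem seed_eq_zero_of_one_lt (x : ℝ) (hx : 1 < x) : seed x = 0 := by
  rw [seed_apply, seedRe_eq_zero_of_one_le (by rw [abs_of_pos (by linarith)]; exact hx.le),
    Complex.ofReal_zero]

/-- The seed vanishes for `|x| ≥ 1`. -/
theorem seed_eq_zero_of_one_le_abs {x : ℝ} (hx : 1 ≤ |x|) : seed x = 0 := by
  rw [seed_apply, seedRe_eq_zero_of_one_le hx, Complex.ofReal_zero]

/-- **The Mellin transform of the seed at `2`** is half the first moment of the bump: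
`𝓜 seed (2) = ½ ∫ x b(x) dx`. -/
theorem mellin_seed_two :
    mellin (fun x : ℝ => seed x) 2 = (((∫ x : ℝ, x * (seedBump : ℝ → ℝ) x) / 2 : ℝ) : ℂ) := by
  set m : ℝ := ∫ x : ℝ, x * (seedBump : ℝ → ℝ) x with hm
  -- the integrand on `(0, ∞)` and its extension by zero
  set φ : ℝ → ℝ := fun x => x * (seedBump : ℝ → ℝ) x - 2 * (x * (seedBump : ℝ → ℝ) (2 * x)) with hφ
  have hφ0 : ∀ x : ℝ, x ≤ 0 → φ x = 0 := fun x hx => by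
    simp only [hφ]
    rw [seedBump_eq_zero (Or.inl (by linarith)), seedBump_eq_zero (Or.inl (by linarith))]
    ring
  have h1 : mellin (fun x : ℝ => seed x) 2 = ∫ x : ℝ in Ioi 0, ((φ x : ℝ) : ℂ) := by
    unfold mellin
    refine setIntegral_congr_fun measurableSet_Ioi fun x (hx : 0 < x) => ?_
    simp only [hφ, seed_apply, seedRe_of_nonneg hx.le, smul_eq_mul]
    rw [show (2 : ℂ) - 1 = 1 by norm_num, cpow_one]
    push_cast
    ring
  have h2 : ∫ x : ℝ in Ioi 0, ((φ x : ℝ) : ℂ) = ∫ x : ℝ, ((φ x : ℝ) : ℂ) := by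
    refine setIntegral_eq_integral_of_forall_compl_eq_zero fun x hx => ?_
    rw [hφ0 x (not_lt.1 hx), Complex.ofReal_zero]
  rw [h1, h2, integral_complex_ofReal]
  congr 1
  -- compute the real integral
  have i1 : Integrable (fun x : ℝ => x * (seedBump : ℝ → ℝ) x) volume :=
    (continuous_id.mul seedBump.continuous).integrable_of_hasCompactSupport
      seedBump.hasCompactSupport.mul_left
  have i2 : Integrable (fun x : ℝ => x * (seedBump : ℝ → ℝ) (2 * x)) volume := by
    have := i1.comp_mul_left' (two_ne_zero)
    -- `this : Integrable (fun x ↦ (2 * x) * b(2 * x))`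
    refine (this.const_mul (1 / 2)).congr (Eventually.of_forall fun x => ?_)
    simp only
    ring
  have e2 : ∫ x : ℝ, x * (seedBump : ℝ → ℝ) (2 * x) = m / 4 := by
    have key := Measure.integral_comp_mul_left (fun y : ℝ => y * (seedBump : ℝ → ℝ) y) 2
    rw [smul_eq_mul, abs_of_pos (by norm_num : (0 : ℝ) < 2⁻¹), ← hm] at key
    have : (fun x : ℝ => x * (seedBump : ℝ → ℝ) (2 * x)) = fun x => (1 / 2) * (2 * x * (seedBump : ℝ → ℝ) (2 * x)) := by
      funext x; ring
    rw [this, integral_const_mul, key]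
    ring
  simp only [hφ]
  rw [integral_sub i1 (i2.const_mul 2), integral_const_mul, ← hm, e2]
  ring

/-- `𝓜 seed (2) ≠ 0`. -/
theorem mellin_seed_two_ne_zero : mellin (fun x : ℝ => seed x) 2 ≠ 0 := by
  rw [mellin_seed_two, Complex.ofReal_ne_zero]
  exact (div_pos integral_mul_seedBump_pos two_pos).ne'

/-- `‖𝓜 seed (2)‖ > 0`. -/
theorem norm_mellin_seed_two_pos : 0 < ‖mellin (fun x : ℝ => seed x) 2‖ :=
  norm_pos_iff.2 mellin_seed_two_ne_zero

end Summit.RiemannHypothesis.RiemannHypothesis.Theorems
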